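import Literature.NumberTheory.LFunctions.NoRealZeroEvenTruncationX14694
import Literature.NumberTheory.LFunctions.NoRealZeroEvenTruncationX14773
import Literature.NumberTheory.LFunctions.NoRealZeroEvenTruncationX14813
import Literature.NumberTheory.LFunctions.NoRealZeroEvenTruncationX14885
import Literature.NumberTheory.LFunctions.NoRealZeroEvenTruncationX14909
import Literature.NumberTheory.LFunctions.NoRealZeroEvenTruncationX14937
import Literature.NumberTheory.LFunctions.NoRealZeroEvenTruncationX14972
import HarnessLib

/-!
# The no-real-zero column on `(14693, 15000]`, both parities, unconditionally (kernel floor, lane A + JOIN)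

Topic `Literature/NumberTheory/LFunctions`; namespace `Literature.NumberTheory.LFunctions`. THEOREMS only
(no definition, no named fact, no `sorry`; standard axioms).  Cell `parity-realchar`, prover seat g10.

Union of the 7 even and 0 odd range files `NoRealZero{Even,Odd}TruncationX<lo>.lean` covering `14694 … 15000`
(JOIN rule of the cell: conductors with an accepted Fekete–Pólya certificate of the second kernel lane — prover-2,
`noRealZero{Odd,Even}_fp_<q>` — are cited by name inside the blocks; the others carry Davenport–Chua truncation
certificates `certDriftOK` / `certMeanOK` decided by ENGINE v3, `DirichletLTruncationCertificatesTables.lean`, the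
parameters per conductor the cheapest passing rung of the exact integer model, kit j287480).  This file is
INDEPENDENT of the levels below `14693` (so that it verifies as soon as its own blocks are built); the ladder step
`NoRealZeroUpTo 15000` is the two-import file `NoRealZeroTruncationBaseNONE.lean`.

* **`noRealZeroEvenOn_14694_15000`**, **`noRealZeroOddOn_14694_15000`** — for every modulus `14693 < q ≤ 15000`, every primitive
  quadratic Dirichlet character `χ` mod `q` of that parity and every `σ ∈ (0, 1)`: `L(σ, χ) ≠ 0`.

WHAT THIS IS NOT: no numerics of record; nothing about complex zeros; no Parity credit (cell rule H5).

## References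

* K. S. Chua, *Real zeros of Dedekind zeta functions of real quadratic fields*, Math. Comp. 74 (2005) 1457–1470. [Chua2005RealZeros]
* M. Watkins, *Real zeros of real odd Dirichlet L-functions*, Math. Comp. 73 (2004) 415–423. [Watkins2004RealZeros]
-/

namespace Literature.NumberTheory.LFunctions

/-- **Even primitive quadratic characters of conductor `14693 < q ≤ 15000` have no real zero in `(0, 1)`.**
[cite: Chua2005RealZeros, Theorem 1.1 (here re-proved in the kernel for this range)] -/
theorem noRealZeroEvenOn_14694_15000 :
    ∀ (q : ℕ) [NeZero q], 14693 < q → q ≤ 15000 →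
      ∀ χ : DirichletCharacter ℂ q, χ.IsQuadratic → χ.IsPrimitive → χ.Even →
        ∀ σ : ℝ, 0 < σ → σ < 1 → χ.LFunction σ ≠ 0 := by
  intro q _ hlo hqN χ hquad hprim hev σ hσ0 hσ1
  by_cases h14772 : q ≤ 14772
  · exact noRealZeroEven_range_14694_14772 q (by omega) h14772 χ hquad hprim hev σ hσ0 hσ1
  by_cases h14812 : q ≤ 14812
  · exact noRealZeroEven_range_14773_14812 q (by omega) h14812 χ hquad hprim hev σ hσ0 hσ1
  by_cases h14884 : q ≤ 14884
  · exact noRealZeroEven_range_14813_14884 q (by omega) h14884 χ hquad hprim hev σ hσ0 hσ1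
  by_cases h14908 : q ≤ 14908
  · exact noRealZeroEven_range_14885_14908 q (by omega) h14908 χ hquad hprim hev σ hσ0 hσ1
  by_cases h14936 : q ≤ 14936
  · exact noRealZeroEven_range_14909_14936 q (by omega) h14936 χ hquad hprim hev σ hσ0 hσ1
  by_cases h14971 : q ≤ 14971
  · exact noRealZeroEven_range_14937_14971 q (by omega) h14971 χ hquad hprim hev σ hσ0 hσ1
  exact noRealZeroEven_range_14972_15000 q (by omega) hqN χ hquad hprim hev σ hσ0 hσ1



end Literature.NumberTheory.LFunctions
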